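import Literature.NumberTheory.EllipticCurves.Rank1Residual.Typed.X10bHeegnerIndexCertificate
import Literature.NumberTheory.EllipticCurves.IsogenyHasCMIffJMemProofs
import Literature.NumberTheory.EllipticCurves.PointCountEulerCriterion
import Summits.BirchSwinnertonDyer.Rank1Residual.X11b.ChaPairsMinimality
import Summits.BirchSwinnertonDyer.BirchSwinnertonDyer.Theorems.Rank1ResidualX11RankOneReduction
import HarnessLib

/-!
# Class X9, rank `0`, `ord₅ #Ш_an = 2`: per-pair KERNEL RECORDS of the `μ`-free closure (Cha upper + exact `5`-descent lower + Cassels–Tate), every Galois / CM / minimality hypothesis decided from the integer model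

HONEST FRAMING (cell `b2b-bsdres-*`, verbatim): the cell deletes COMBINATION-SHAPED residual classes of
the rank-≤1 BSD formula from PUBLISHED theorems only and TYPES the construction-shaped remainder; this
is not "finishing BSD". Class X9 (good ordinary `p ≥ 5`, `ρ̄_{E,p}` irreducible and not surjective)
stays TYPED at class level; everything here is PER PAIR; no lane verdict is changed; no named fact;
nothing is booked by this unit (the lane books, the referee rules). Unit `b2b-bsdres-x9`, gen 13.

Companion of `X9/ChaDescentRoute.lean` (gen 13: the class-level shape over `ClassX9 W p`). Here the
same combination is delivered for LITERAL Cremona models with NO class hypothesis at all: the generic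
consumer `bsdp_of_ainvs_of_cha_of_selmerGroup_ne_bot` takes an integral model `[a₁,…,a₆]` of a globally
minimal `W` and DECIDES in the kernel (i) `E[5]` irreducible — a good prime `ℓ ≠ 5` with kernel point
count `#Ẽ(𝔽_ℓ) = n` and `X² − (ℓ+1−n)X + ℓ` root-free mod `5` (Mazur 1978 Prop. 6.3 (1), tree
`IntModel.hasIrreducibleModPGaloisRep_of_intModel_of_noroot`, x11c gen 3–4's toolkit) — and (ii) `E`
non-CM — `j(E) = c₄³/Δ` is none of the thirteen CM `j`-invariants (tree theorem
`WeierstrassCurve.hasCM_iff_j_mem_holds`, Silverman AEC App. C §11) —, then applies the tree's class-free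
`Typed.bsdp_of_cha_of_casselsTate_of_selmerGroup_ne_bot` (x10b): Gross–Zagier–Kolyvagin (`hGZK`),
Cassels–Tate (`hCT`), Cha 2005 = Miller 2011 Thm. 5.2 (`hCha`; irreducibility suffices, no surjectivity),
`r_an = 0`, `ord₅ #Ш_an = 2`, a Heegner field `K` (`5 ∤ d_K`, `25 ∤ N`) whose Heegner point has index of
`5`-adic order `≤ 1`, and the descent line `Sel^(5)(E/ℚ) ≠ 0` ⟹ `BSD(E,5)` (and `#Ш(E)[5^∞] = 25` exactly).
Per record the kernel also decides `Δ ≠ 0` and GLOBAL MINIMALITY of Cremona's model (Kraus 1989 /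
Silverman VII Remark 1.1, tree `isGloballyMinimal_of_krausCriterion_bounded₂`, x11c).

The records of THIS file (`351424bn1`, `131043s1`) are the two rank-`0` X9 "SHA rows" of the census (`N < 5·10⁵`) with image `5Ns`:
each carries a Heegner-index row with `ord₅ m = 1` on two engines (gens 9–12, `HOME/b2b-bsdres-x9/g12/fold/fold_g12.rows.tsv`)
and an EXACT, UNCONDITIONAL `5`-descent line `dim_𝔽₅ Sel^(5)(E/ℚ) = 2` from x11c's Shapiro descent over the octic field
(`351424bn1`: gen 12, kit j103105; `131043s1`: the gen-12 engine with this unit's gen-13 `S`-enlargement patch, kit j105889 —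
the gen-12 run had aborted at the guard `5 ∣ #Cl_S(L)`): `bnfcertify = 1`, `5`-saturated, independent verifier VERIFIED.
The ten `5S4` SHA rows (full `5`-descent over the degree-`24` field `ℚ(E[5]∖0)`, x11c gen-13 `s4desc`; class group GRH or
Zimmert-certified per row) are recorded in the companion `X9/ChaDescentRecordsS4.lean` with the generic theorems of this file.
The remaining `5`-adic SHA row `199988e1` (index `ord₅ = 2` at every field: `c₁₇₃ = 5`) is not a record (its upper half is
Jetchev's, flagged). Not a class theorem; `hSel`, the Heegner datum and `#Ш_an` are displayed binders exactly as in x11c's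
`X11b/ChaPairs*.lean`.

References: B. Cha, J. Number Theory 111 (2005); R. L. Miller, LMS J. Comput. Math. 14 (2011) Thm. 5.2,
Def. 1.1 [Miller2011LMS]; J. W. S. Cassels 1962 / Silverman AEC Thm. X.4.14 [SilvermanAEC2009]; B. Mazur,
Invent. Math. 44 (1978) Prop. 6.3 (1) [Mazur1978]; A. Kraus, Manuscripta Math. 65 (1989) [Kraus1989];
E. F. Schaefer, M. Stoll, Trans. AMS 356 (2004) §3; J. E. Cremona, Algorithms (1997) / tables [Cremona2006].
-/

set_option autoImplicit false

noncomputable section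

open scoped Classical

open WeierstrassCurve Literature.NumberTheory.EllipticCurves
  Literature.NumberTheory.EllipticCurves.Rank1Residual
  Literature.NumberTheory.EllipticCurves.Rank1Residual.Typed
  Literature.NumberTheory.EllipticCurves.Rank1Residual.X11RankOneCertificates
  Summit.BirchSwinnertonDyer.BirchSwinnertonDyer.Rank1Residual.IntModel
  Summit.BirchSwinnertonDyer.BirchSwinnertonDyer.Rank1Residual.X11RankOne
  Summit.BirchSwinnertonDyer.Rank1Residual.X11b

namespace Summit.BirchSwinnertonDyer.Rank1Residual.X9

/-! ### §1. The record shape for a literal integer model (class-free; Galois / CM data kernel-decided) -/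

/-- `j(W) = c₄³/Δ` read off the integral model of a globally minimal `W`. [cite: SilvermanAEC2009, III.1] -/
theorem j_eq_of_intModel {W : WeierstrassCurve ℚ} [W.IsElliptic] [W.IsGloballyMinimal]
    (a1 a2 a3 a4 a6 : ℤ) (hW : integralModelInt W = ⟨a1, a2, a3, a4, a6⟩) :
    W.j = ((c4Of [a1, a2, a3, a4, a6] ^ 3 : ℤ) : ℚ) / ((discOf [a1, a2, a3, a4, a6] : ℤ) : ℚ) := by
  have hΔ : W.Δ = ((discOf [a1, a2, a3, a4, a6] : ℤ) : ℚ) := by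
    rw [Δ_eq_cast hW, intCurve_Δ]
  have hc4 : W.c₄ = ((c4Of [a1, a2, a3, a4, a6] : ℤ) : ℚ) := by
    rw [c₄_eq_cast hW, intCurve_c₄]
  rw [WeierstrassCurve.j, Units.val_inv_eq_inv_val, coe_Δ', hΔ, hc4]
  push_cast
  rw [div_eq_inv_mul]

/-- **`BSD(E,p)` (rank `0`, `ord_p #Ш_an = 2`) from Cha's index bound + a `p`-descent line + Cassels–Tate,
for a globally minimal `W/ℚ` with integral model `[a₁,…,a₆]`, every Galois / CM hypothesis from DECIDABLE
integer data**: `p` odd; `j = c₄³/Δ ∉` the thirteen CM `j`-invariants (`E` non-CM, Silverman App. C §11);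
a good prime `ℓ ≠ p` (`ℓ ∤ Δ`) with kernel point count `#Ẽ(𝔽_ℓ) = n` and `X² − (ℓ + 1 − n)X + ℓ` root-free
mod `p` (`E[p]` irreducible, Mazur 1978 Prop. 6.3 (1)). PUBLISHED binders `hGZK`, `hCT`, `hCha`; certificate
binders: `r_an = 0`, the Heegner field `K` (Heegner hypothesis for the level `N`, `p ∤ d_K`, `p² ∤ N`) and
point `P` of infinite order with `ord_p [E(K) : ℤ P] ≤ 1`, `#Ш_an = q` with `ord_p q = 2`, and
`Sel^(p)(E/ℚ) ≠ 0`. Composition of `Typed.bsdp_of_cha_of_casselsTate_of_selmerGroup_ne_bot` with the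
`IntModel` toolkit. Per pair; not a class theorem. [cite: Miller2011LMS, Thm. 5.2 and Def. 1.1]
[cite: Mazur1978, §6 Prop. 6.3 (1) (p. 153)] [cite: SilvermanAEC2009, Thm. X.4.14 and App. C §11] -/
theorem bsdp_of_ainvs_of_cha_of_selmerGroup_ne_bot
    (hGZK : rank_eq_analyticRank_of_analyticRank_le_one)
    (hCT : exists_casselsTate_pairing (K := ℚ)) (hCha : Cha2005.thm52_padicValNat_shaOrder_le)
    (a1 a2 a3 a4 a6 : ℤ) {W : WeierstrassCurve ℚ} [W.IsElliptic] [W.IsGloballyMinimal]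
    (hW : integralModelInt W = ⟨a1, a2, a3, a4, a6⟩) (p ℓ n : ℕ) [Fact p.Prime] [Fact ℓ.Prime]
    (hp2 : p ≠ 2)
    (hj : ((c4Of [a1, a2, a3, a4, a6] ^ 3 : ℤ) : ℚ) / ((discOf [a1, a2, a3, a4, a6] : ℤ) : ℚ) ∉
      cmJInvariants)
    (hℓp : ℓ ≠ p) (hℓΔ : ¬ (ℓ : ℤ) ∣ discOf [a1, a2, a3, a4, a6])
    (hcard : Nat.card (((⟨a1, a2, a3, a4, a6⟩ : WeierstrassCurve ℤ).map
      (Int.castRingHom (ZMod ℓ))).toAffine.Point) = n)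
    (hnoroot : ∀ t : ℕ, t < p → ¬ (p : ℤ) ∣ (t : ℤ) ^ 2 - ((ℓ : ℤ) + 1 - n) * t + ℓ)
    (hr : W.analyticRank = 0)
    {N : ℕ} [NeZero N] {K : Type} [Field K] [NumberField K] (hK : IsImaginaryQuadratic K)
    (hH : SatisfiesHeegnerHypothesis N K) {P : (W.baseChange K).toAffine.Point}
    (hP : IsHeegnerPoint N W K P) (hnt : ¬ IsOfFinAddOrder P)
    (hpD : ¬ (p : ℤ) ∣ NumberField.discr K) (hpN : ¬ p ^ 2 ∣ N)
    (hI : padicValNat p (AddSubgroup.zmultiples P).index ≤ 1)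
    {q : ℚ} (hq : shaAn W = (q : ℂ)) (hv : padicValRat p q = 2)
    (hSel : W.selmerGroup (p : ℤ) ≠ ⊥) : BSDp W p := by
  haveI : NeZero p := ⟨(Fact.out : p.Prime).ne_zero⟩
  have hΔ : (⟨a1, a2, a3, a4, a6⟩ : WeierstrassCurve ℤ).Δ = discOf [a1, a2, a3, a4, a6] :=
    intCurve_Δ a1 a2 a3 a4 a6
  have hcm : ¬ W.HasCM := fun hCM ↦
    hj (j_eq_of_intModel a1 a2 a3 a4 a6 hW ▸ (hasCM_iff_j_mem_holds W).mp hCM)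
  have hirr : Irr W p := by
    refine hasIrreducibleModPGaloisRep_of_intModel_of_noroot hW p ℓ hℓp (by rw [hΔ]; exact hℓΔ) hcard
      (forall_zmod_of_forall_lt fun t ht h0 ↦ hnoroot t ht ?_)
    rw [← ZMod.intCast_zmod_eq_zero_iff_dvd]
    push_cast at h0 ⊢
    linear_combination h0
  exact Typed.bsdp_of_cha_of_casselsTate_of_selmerGroup_ne_bot W p hGZK hCT hCha hcm hr hK hH hP
    hnt hp2 hpD hpN hirr hI hq hv hSel

/-- **The exact `p`-part under the same data (no analytic `Ш` value needed): `ord_p #Ш(E/ℚ) = 2`.**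
[cite: Miller2011LMS, Thm. 5.2] [cite: Mazur1978, §6 Prop. 6.3 (1) (p. 153)] [cite: SilvermanAEC2009, Thm. X.4.14 and App. C §11] -/
theorem padicValNat_shaOrder_eq_two_of_ainvs_of_cha_of_selmerGroup_ne_bot
    (hGZK : rank_eq_analyticRank_of_analyticRank_le_one)
    (hCT : exists_casselsTate_pairing (K := ℚ)) (hCha : Cha2005.thm52_padicValNat_shaOrder_le)
    (a1 a2 a3 a4 a6 : ℤ) {W : WeierstrassCurve ℚ} [W.IsElliptic] [W.IsGloballyMinimal]
    (hW : integralModelInt W = ⟨a1, a2, a3, a4, a6⟩) (p ℓ n : ℕ) [hp : Fact p.Prime] [Fact ℓ.Prime]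
    (hp2 : p ≠ 2)
    (hj : ((c4Of [a1, a2, a3, a4, a6] ^ 3 : ℤ) : ℚ) / ((discOf [a1, a2, a3, a4, a6] : ℤ) : ℚ) ∉
      cmJInvariants)
    (hℓp : ℓ ≠ p) (hℓΔ : ¬ (ℓ : ℤ) ∣ discOf [a1, a2, a3, a4, a6])
    (hcard : Nat.card (((⟨a1, a2, a3, a4, a6⟩ : WeierstrassCurve ℤ).map
      (Int.castRingHom (ZMod ℓ))).toAffine.Point) = n)
    (hnoroot : ∀ t : ℕ, t < p → ¬ (p : ℤ) ∣ (t : ℤ) ^ 2 - ((ℓ : ℤ) + 1 - n) * t + ℓ)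
    (hr : W.analyticRank = 0)
    {N : ℕ} [NeZero N] {K : Type} [Field K] [NumberField K] (hK : IsImaginaryQuadratic K)
    (hH : SatisfiesHeegnerHypothesis N K) {P : (W.baseChange K).toAffine.Point}
    (hP : IsHeegnerPoint N W K P) (hnt : ¬ IsOfFinAddOrder P)
    (hpD : ¬ (p : ℤ) ∣ NumberField.discr K) (hpN : ¬ p ^ 2 ∣ N)
    (hI : padicValNat p (AddSubgroup.zmultiples P).index ≤ 1)
    (hSel : W.selmerGroup (p : ℤ) ≠ ⊥) : padicValNat p W.shaOrder = 2 := by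
  haveI : NeZero p := ⟨hp.out.ne_zero⟩
  have hΔ : (⟨a1, a2, a3, a4, a6⟩ : WeierstrassCurve ℤ).Δ = discOf [a1, a2, a3, a4, a6] :=
    intCurve_Δ a1 a2 a3 a4 a6
  have hcm : ¬ W.HasCM := fun hCM ↦
    hj (j_eq_of_intModel a1 a2 a3 a4 a6 hW ▸ (hasCM_iff_j_mem_holds W).mp hCM)
  have hirr : Irr W p := by
    refine hasIrreducibleModPGaloisRep_of_intModel_of_noroot hW p ℓ hℓp (by rw [hΔ]; exact hℓΔ) hcard
      (forall_zmod_of_forall_lt fun t ht h0 ↦ hnoroot t ht ?_)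
    rw [← ZMod.intCast_zmod_eq_zero_iff_dvd]
    push_cast at h0 ⊢
    linear_combination h0
  have hr1 : W.analyticRank ≤ 1 := by rw [hr]; norm_num
  have hrank : W.mordellWeilRank = 0 := by rw [(hGZK W hr1).1, hr]
  have htors : ¬ p ∣ W.torsionOrder := by
    intro hd
    have h0 := padicValNat_torsionOrder_eq_zero_of_irreducible W p hirr
    rw [padicValNat.eq_zero_iff] at h0
    rcases h0 with h | h | h
    · exact absurd h hp.out.one_lt.ne'
    · exact absurd h W.torsionOrder_pos_holds.ne'
    · exact h hd
  have hdvd : p ∣ W.shaOrder :=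
    dvd_shaOrder_of_exists_torsion W p
      (exists_sha_torsion_of_selmerGroup_ne_bot W p hSel hrank htors)
  simpa using Typed.padicValNat_shaOrder_eq_of_cha_of_casselsTate_of_dvd W p hGZK hCT hCha hcm hr1
    hK hH hP hnt hp2 hpD hpN hirr (k := 1) hI (by simpa using hdvd)

/-! ### §2. Frobenius point-count certificates (kernel-decided data) -/

/-- `#Ẽ(𝔽_3) = 4` (`a_3 = 0`; `X² − a_3X + 3` root-free mod `5`) for Cremona's model `351424bn1` (kernel count). [folklore] -/
theorem card_c351424bn1_3 :
    Nat.card (((⟨0, 0, 0, -4046, -2977278⟩ : WeierstrassCurve ℤ).map (Int.castRingHom (ZMod 3))).toAffine.Point) = 4 := by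
  rw [@WeierstrassCurve.natCard_point_eq_one_add_card (ZMod 3) (@ZMod.instField 3 ⟨by norm_num⟩) _ _ _
    (by decide +kernel), @card_sol_eq_sum_euler (ZMod 3) (@ZMod.instField 3 ⟨by norm_num⟩) _ _
    (by rw [ZMod.ringChar_zmod_n]; decide), ZMod.card]
  decide +kernel

/-- `#Ẽ(𝔽_7) = 8` (`a_7 = 0`; `X² − a_7X + 7` root-free mod `5`) for Cremona's model `131043s1` (kernel count). [folklore] -/
theorem card_c131043s1_7 :
    Nat.card (((⟨0, -1, 1, -341468937, -2460194780407⟩ : WeierstrassCurve ℤ).map (Int.castRingHom (ZMod 7))).toAffine.Point) = 8 := by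
  rw [@WeierstrassCurve.natCard_point_eq_one_add_card (ZMod 7) (@ZMod.instField 7 ⟨by norm_num⟩) _ _ _
    (by decide +kernel), @card_sol_eq_sum_euler (ZMod 7) (@ZMod.instField 7 ⟨by norm_num⟩) _ _
    (by rw [ZMod.ringChar_zmod_n]; decide), ZMod.card]
  decide +kernel

/-! ### §3. The records -/

/-- **`BSD(E,5)` for `351424bn1`** (`N = 351424 = 2⁶·17²·19`; `5 ∤ N`: GOOD ORDINARY at `5`, `a₅ = 3` — class X9; Cremona model
`[0, 0, 0, -4046, -2977278]`; `ρ̄_{E,5}` irreducible, NOT surjective, of split-Cartan-normaliser type `5Ns`; analytic rank `0`, `#Ш_an = 25` (`ord₅ = 2`);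
c₂ = 1 (II), c₁₇ = 1 (I0*), c₁₉ = 1 (I5); bad primes `2` add, `17` add, `19` mult; `j = -4741632/2476099`) — an X9 "SHA row", closed here `μ`-FREE: UPPER half Cha 2005 with the
Heegner-index certificate of the X9 census — index-`ord₅ = 1` rows (two engines, `m_e1 = m_e2`; `HOME/b2b-bsdres-x9/g12/fold/fold_g12.rows.tsv`):
`D = -127`, `m = 10` (engine 1 gen-12 j103359, ENGINE 2 agree); `D = -151`, `m = 10` (engine 1 gen-12 j103359, ENGINE 2 agree) — so `ord₅ [E(K) : ℤ y_K] ≤ 1` —, LOWER half the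
descent line: `dim_𝔽₅ Sel^(5)(E/ℚ) = 2` — x11c gen-12 Shapiro `5`-descent over the octic field `L` (byte copies), unit x9 gen-12 run of record + verifier j103105 (and again gen-13 j105889): mode EXACT (`bnfcertify(bnf_L,1) = 1`, `5`-saturated, all local images complete), verifier VERIFIED; UNCONDITIONAL; so `Ш(E)[5] ≠ 0`, `25 ∣ #Ш` (Cassels–Tate), `ord₅ #Ш ≤ 2` (Cha): `#Ш(E)[5^∞] = 25`. Kernel-decided: `Δ ≠ 0`, global minimality (Kraus),
`E[5]` irreducible (`ℓ = 3`, `#Ẽ(𝔽_3) = 4`, `a_3 = 0`, `X² − a_3X + 3` root-free mod `5`), non-CM (`j ∉` the 13 CM values).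
Binders: `hGZK`, `hCT`, `hCha` (published); `r_an = 0`, `#Ш_an` (`ord₅ = 2`), the Heegner datum with its index certificate, `hSel` (the descent line).
[cite: Miller2011LMS, Thm. 5.2 and Def. 1.1] [cite: SilvermanAEC2009, Thm. X.4.14] [cite: Cremona2006, Table 1 (Cremona label 351424bn1)] -/
theorem bsdp_c351424bn1 (hGZK : rank_eq_analyticRank_of_analyticRank_le_one)
    (hCT : exists_casselsTate_pairing (K := ℚ)) (hCha : Cha2005.thm52_padicValNat_shaOrder_le)
    (W : WeierstrassCurve ℚ) (hW : W = ⟨0, 0, 0, -4046, -2977278⟩)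
    (hr : W.analyticRank = 0)
    {N : ℕ} [NeZero N] {K : Type} [Field K] [NumberField K] (hK : IsImaginaryQuadratic K)
    (hH : SatisfiesHeegnerHypothesis N K) {P : (W.baseChange K).toAffine.Point}
    (hP : IsHeegnerPoint N W K P) (hnt : ¬ IsOfFinAddOrder P)
    (hpD : ¬ (5 : ℤ) ∣ NumberField.discr K) (hpN : ¬ 5 ^ 2 ∣ N)
    (hI : padicValNat 5 (AddSubgroup.zmultiples P).index ≤ 1)
    {q : ℚ} (hq : shaAn W = (q : ℂ)) (hv : padicValRat 5 q = 2)
    (hSel : W.selmerGroup (5 : ℤ) ≠ ⊥) : BSDp W 5 := by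
  subst hW
  haveI := isElliptic_of_discOf_ne_zero 0 0 0 (-4046) (-2977278) (by decide +kernel)
  haveI := isGloballyMinimal_of_krausCriterion_bounded₂ 0 0 0 (-4046) (-2977278) (by decide +kernel) (by decide +kernel)
    (by decide +kernel)
  haveI : Fact (Nat.Prime 5) := ⟨by norm_num⟩
  haveI : Fact (Nat.Prime 3) := ⟨by norm_num⟩
  exact bsdp_of_ainvs_of_cha_of_selmerGroup_ne_bot hGZK hCT hCha 0 0 0 (-4046) (-2977278)
    (integralModelInt_eq_of_map_eq _ (map_mk_int _ _ _ _ _)) 5 3 4 (by decide) (by decide +kernel)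
    (by decide) (by decide +kernel) card_c351424bn1_3 (by decide +kernel) hr hK hH hP hnt
    (mod_cast hpD) hpN hI hq hv hSel

/-- **`BSD(E,5)` for `131043s1`** (`N = 131043 = 3·11²·19²`; `5 ∤ N`: GOOD ORDINARY at `5`, `a₅ = 2` — class X9; Cremona model
`[0, -1, 1, -341468937, -2460194780407]`; `ρ̄_{E,5}` irreducible, NOT surjective, of split-Cartan-normaliser type `5Ns`; analytic rank `0`, `#Ш_an = 25` (`ord₅ = 2`);
c₃ = 1 (I5), c₁₁ = 2 (III*), c₁₉ = 2 (I5*); bad primes `3` mult, `11` add, `19` add; `j = -39693696892928/601692057`) — an X9 "SHA row", closed here `μ`-FREE: UPPER half Cha 2005 with the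
Heegner-index certificate of the X9 census — index-`ord₅ = 1` rows (two engines, `m_e1 = m_e2`; `HOME/b2b-bsdres-x9/g12/fold/fold_g12.rows.tsv`):
`D = -8`, `m = 40` (engine 1 j070731, ENGINE 2 agree) — so `ord₅ [E(K) : ℤ y_K] ≤ 1` —, LOWER half the
descent line: `dim_𝔽₅ Sel^(5)(E/ℚ) = 2` — x11c gen-12 Shapiro `5`-descent over the octic field `L` with this unit's gen-13 `S`-ENLARGEMENT patch (the gen-12 run aborted at the guard `5 ∣ #Cl_S(L)`; `S` = primes of `5N` `∪ {29}`, local condition at `29` = image of `E(ℚ₂₉)`), run of record + verifier j105889: mode EXACT (`bnfcertify(bnf_L,1) = 1`, `5`-saturated, all local images complete), verifier VERIFIED; UNCONDITIONAL; so `Ш(E)[5] ≠ 0`, `25 ∣ #Ш` (Cassels–Tate), `ord₅ #Ш ≤ 2` (Cha): `#Ш(E)[5^∞] = 25`. Kernel-decided: `Δ ≠ 0`, global minimality (Kraus),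
`E[5]` irreducible (`ℓ = 7`, `#Ẽ(𝔽_7) = 8`, `a_7 = 0`, `X² − a_7X + 7` root-free mod `5`), non-CM (`j ∉` the 13 CM values).
Binders: `hGZK`, `hCT`, `hCha` (published); `r_an = 0`, `#Ш_an` (`ord₅ = 2`), the Heegner datum with its index certificate, `hSel` (the descent line).
[cite: Miller2011LMS, Thm. 5.2 and Def. 1.1] [cite: SilvermanAEC2009, Thm. X.4.14] [cite: Cremona2006, Table 1 (Cremona label 131043s1)] -/
theorem bsdp_c131043s1 (hGZK : rank_eq_analyticRank_of_analyticRank_le_one)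
    (hCT : exists_casselsTate_pairing (K := ℚ)) (hCha : Cha2005.thm52_padicValNat_shaOrder_le)
    (W : WeierstrassCurve ℚ) (hW : W = ⟨0, -1, 1, -341468937, -2460194780407⟩)
    (hr : W.analyticRank = 0)
    {N : ℕ} [NeZero N] {K : Type} [Field K] [NumberField K] (hK : IsImaginaryQuadratic K)
    (hH : SatisfiesHeegnerHypothesis N K) {P : (W.baseChange K).toAffine.Point}
    (hP : IsHeegnerPoint N W K P) (hnt : ¬ IsOfFinAddOrder P)
    (hpD : ¬ (5 : ℤ) ∣ NumberField.discr K) (hpN : ¬ 5 ^ 2 ∣ N)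
    (hI : padicValNat 5 (AddSubgroup.zmultiples P).index ≤ 1)
    {q : ℚ} (hq : shaAn W = (q : ℂ)) (hv : padicValRat 5 q = 2)
    (hSel : W.selmerGroup (5 : ℤ) ≠ ⊥) : BSDp W 5 := by
  subst hW
  haveI := isElliptic_of_discOf_ne_zero 0 (-1) 1 (-341468937) (-2460194780407) (by decide +kernel)
  haveI := isGloballyMinimal_of_krausCriterion_bounded₂ 0 (-1) 1 (-341468937) (-2460194780407) (by decide +kernel) (by decide +kernel)
    (by decide +kernel)
  haveI : Fact (Nat.Prime 5) := ⟨by norm_num⟩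
  haveI : Fact (Nat.Prime 7) := ⟨by norm_num⟩
  exact bsdp_of_ainvs_of_cha_of_selmerGroup_ne_bot hGZK hCT hCha 0 (-1) 1 (-341468937) (-2460194780407)
    (integralModelInt_eq_of_map_eq _ (map_mk_int _ _ _ _ _)) 5 7 8 (by decide) (by decide +kernel)
    (by decide) (by decide +kernel) card_c131043s1_7 (by decide +kernel) hr hK hH hP hnt
    (mod_cast hpD) hpN hI hq hv hSel

end Summit.BirchSwinnertonDyer.Rank1Residual.X9

end
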